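import Summits.Ventures.QEC.Census.AdditiveCertLanes
import HarnessLib

/-!
# `AddCert` lane replay, II: coverage — every low-weight Pauli word is a valid lane; `Reaches4` (theorems only)

Sequel of `Census/AdditiveCertLanes.lean` (definitions, encoding, letter rows). Here: the validity mask accepts the
canonical lane of a lettered selection (`testBit_validMask_of`), the masked family check is sound lane by lane
(`familyOKv_sound`, cf. type-01's `familyOK_sound`), and the ASSEMBLY: passing `laneCheck`s on segments covering the
`3n` letter rows give type-02's `leaf` at every nonempty non-identity selection of `≤ d − 1` qubits
(`AddCert.leaf_of_laneChecks`), hence `Reaches4 (leaf n rows allowList) (range n) (d − 1) 0 0`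
(`AddCert.reaches4_of_lanes`) — the proposition type-02's chunked replay establishes. Standard axioms.
-/

set_option autoImplicit false

namespace Summit.Ventures.QEC.Census

open Literature.InformationTheory.QuantumCodes Plane List

/-! ## The validity mask -/

/-- **A lane spelling a triple-free index set is valid**: if bit `b` of `χ_i` is `[off + i ∈ J]` and no two members of
`J` share a triple `{3q, 3q+1, 3q+2}`, then bit `b` of the mask is set. -/
theorem testBit_validMask_of (J : List ℕ) (hJ : ∀ x ∈ J, ∀ y ∈ J, x / 3 = y / 3 → x = y) (b N : ℕ) (hb : b < N) :
    ∀ (X : List ℕ) (off : ℕ), 3 ∣ off → (∀ i, (X.getD i 0).testBit b = decide (off + i ∈ J)) →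
      (validMask N X).testBit b = true
  | a :: a' :: e :: rest, off, h3, hX => by
    have ha : a.testBit b = decide (off ∈ J) := by simpa using hX 0
    have ha' : a'.testBit b = decide (off + 1 ∈ J) := by simpa using hX 1
    have he : e.testBit b = decide (off + 2 ∈ J) := by simpa using hX 2
    have hrest := testBit_validMask_of J hJ b N hb rest (off + 3) (by omega) fun i => by
      have := hX (i + 3)
      simpa [show off + (i + 3) = off + 3 + i by omega] using this
    have n01 : ¬ (off ∈ J ∧ off + 1 ∈ J) := fun ⟨h0, h1⟩ => by
      have := hJ _ h0 _ h1 (by omega); omega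
    have n02 : ¬ (off ∈ J ∧ off + 2 ∈ J) := fun ⟨h0, h1⟩ => by
      have := hJ _ h0 _ h1 (by omega); omega
    have n12 : ¬ (off + 1 ∈ J ∧ off + 2 ∈ J) := fun ⟨h0, h1⟩ => by
      have := hJ _ h0 _ h1 (by omega); omega
    rw [validMask, Nat.testBit_land, hrest, Nat.testBit_xor, testBit_ones, Nat.testBit_lor, Nat.testBit_lor,
      Nat.testBit_land, Nat.testBit_land, Nat.testBit_land, ha, ha', he]
    simp only [hb, decide_true, Bool.and_true]
    by_cases h0 : off ∈ J <;> by_cases h1 : off + 1 ∈ J <;> by_cases h2 : off + 2 ∈ J <;> simp_all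
  | [], off, _, _ => by show (ones N).testBit b = true; rw [testBit_ones]; simpa using hb
  | [_], off, _, _ => by show (ones N).testBit b = true; rw [testBit_ones]; simpa using hb
  | [_, _], off, _, _ => by show (ones N).testBit b = true; rw [testBit_ones]; simpa using hb

/-! ## One family with validity mask: soundness (cf. type-01's `familyOK_sound`) -/

/-- **A passing masked family check**, lane by lane: for every VALID lane `b < N`, either its word has at least
`θ ≥ 1` set bits among `cols`, or `bzLeaf` holds at its decoded (selection word, word). -/
theorem familyOKv_sound {wmax : ℕ} {cols allow G : List ℕ} {fam : ℕ × List ℕ} {θ fuel : ℕ} (hθ : 1 ≤ θ)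
    (h : familyOKv wmax cols allow G fam θ fuel = true) (b : ℕ) (hb : b < fam.1)
    (hv : (validMask fam.1 fam.2).testBit b = true) :
    θ ≤ (cols.filter fun q => (laneSel b G fam.2 0 0 0).2.testBit q).length ∨
      bzLeaf wmax allow (laneSel b G fam.2 0 0 0).1 (laneSel b G fam.2 0 0 0).2 = true := by
  rw [familyOKv] at h
  by_cases hp : θ ≤ (cols.filter fun q => (laneSel b G fam.2 0 0 0).2.testBit q).length
  · exact Or.inl hp
  · right
    exact laneLeaf_of_failLoop wmax allow G fam.2 fuel _ h b (by
      rw [Nat.testBit_land, hv, Nat.testBit_xor, testBit_ones, testBit_passMask b θ hθ]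
      simp [hb, hp])

/-! ## Small word facts -/

/-- `xorList (l ++ [a]) = xorList l ^^^ a`. -/
theorem xorList_concat (a : ℕ) : ∀ l : List ℕ, xorList (l ++ [a]) = xorList l ^^^ a
  | [] => by simp [xorList]
  | x :: l => by rw [List.cons_append, xorList, xorList, xorList_concat a l, Nat.xor_assoc]

/-- The selection word of a nonempty increasing index list is nonzero (its top bit is set). -/
theorem xorList_pow_concat_ne_zero (J' : List ℕ) (m : ℕ) (hlt : ∀ j ∈ J', j < m) :
    xorList ((J' ++ [m]).map fun j => 2 ^ j) ≠ 0 := by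
  intro h0
  have hl : xorList (J'.map fun j => 2 ^ j) < 2 ^ m :=
    xorList_lt m _ fun x hx => by
      obtain ⟨j, hj, rfl⟩ := List.mem_map.1 hx
      exact Nat.pow_lt_pow_right (by norm_num) (hlt j hj)
  have := congrArg (fun x => x.testBit m) h0
  simp only [List.map_append, List.map_cons, List.map_nil, xorList_concat, Nat.testBit_xor,
    Nat.testBit_lt_two_pow hl, Nat.testBit_two_pow_self, Nat.zero_testBit] at this
  simp at this

/-! ## Soundness of the lane replay: `Reaches4` -/

namespace AddCert

variable (c : AddCert)

/-- **Core**: under passing lane checks on segments covering the `3n` letter rows, every nonempty non-identity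
lettered selection of `≤ d − 1` qubits `< n` (increasing) passes type-02's `leaf` at its word. -/
theorem leaf_of_laneChecks (segs : List (ℕ × ℕ)) (fuel : ℕ)
    (hcov : ∀ m < 3 * c.n, ∃ i < segs.length,
      (segs.getD i (0, 0)).1 ≤ m ∧ m < (segs.getD i (0, 0)).1 + (segs.getD i (0, 0)).2)
    (hok : ∀ i < segs.length, c.laneCheck (segs.getD i (0, 0)).1 (segs.getD i (0, 0)).2 fuel = true)
    (hbnd : ∀ a ∈ c.allowList, a.1 < 2 ^ c.n ∧ a.2 < 2 ^ c.n)
    (S : Sel) (hsub : (S.map Prod.fst).Sublist (List.range c.n)) (hlen : S.length ≤ c.d - 1)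
    (hnz : ∀ e ∈ S, (e.2.1 || e.2.2) = true) (hne : S ≠ []) :
    leaf c.n c.rows c.allowList (accX S) (accZ S) = true := by
  -- qubits are `< n` and strictly increasing
  have hlt : ∀ e ∈ S, e.1 < c.n := fun e he =>
    List.mem_range.1 (hsub.subset (List.mem_map.2 ⟨e, he, rfl⟩))
  have hpw : (S.map Prod.fst).Pairwise (· < ·) := List.pairwise_lt_range.sublist hsub
  have hnodup : (S.map Prod.fst).Nodup := hpw.imp (fun h => Nat.ne_of_lt h)
  -- the index list `J`
  have hJpw : (S.map lidx).Pairwise (· < ·) := by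
    rw [List.pairwise_map] at hpw ⊢
    exact hpw.imp fun {e e'} h => by
      have h1 := lidx_bounds e; have h2 := lidx_bounds e'; omega
  have hJtf : ∀ x ∈ S.map lidx, ∀ y ∈ S.map lidx, x / 3 = y / 3 → x = y := by
    intro x hx y hy hxy
    obtain ⟨e, he, rfl⟩ := List.mem_map.1 hx
    obtain ⟨e', he', rfl⟩ := List.mem_map.1 hy
    rw [lidx_div, lidx_div] at hxy
    have : e = e' := List.inj_on_of_nodup_map hnodup he he' hxy
    rw [this]
  have hJlt : ∀ i ∈ S.map lidx, i < c.letterRows.length := by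
    intro i hi
    obtain ⟨e, he, rfl⟩ := List.mem_map.1 hi
    rw [c.length_letterRows]
    have := lidx_bounds e; have := hlt e he; omega
  -- split off the last entry
  obtain ⟨S', e, rfl⟩ : ∃ S' e, S = S' ++ [e] := ⟨S.dropLast, S.getLast hne, (List.dropLast_append_getLast hne).symm⟩
  have hJ : (S' ++ [e]).map lidx = S'.map lidx ++ [lidx e] := by simp
  have hm : lidx e < 3 * c.n := by
    have := lidx_bounds e; have := hlt e (by simp); omega
  have hJ'lt : ∀ j ∈ S'.map lidx, j < lidx e := by
    rw [hJ, List.pairwise_append] at hJpw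
    intro j hj
    exact hJpw.2.2 j hj (lidx e) (by simp)
  have hJ'pw : (S'.map lidx).Pairwise (· < ·) := by
    rw [hJ, List.pairwise_append] at hJpw; exact hJpw.1
  -- the segment containing the last letter row
  obtain ⟨i, hi, hm0, hms⟩ := hcov (lidx e) hm
  have hfam := hok i hi
  set m0 := (segs.getD i (0, 0)).1
  set s := (segs.getD i (0, 0)).2
  rw [laneCheck] at hfam
  -- the lane covering `J`
  have hcovers : Covers (segment (c.d - 1) m0 s) (S'.map lidx ++ [lidx e]) :=
    covers_segment (c.d - 1) m0 s hm0 hms (S'.map lidx) hJ'pw hJ'lt (by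
      have : (S' ++ [e]).length ≤ c.d - 1 := hlen
      simp only [List.length_append, List.length_singleton, List.length_map] at this ⊢; omega)
  rw [← hJ] at hcovers
  obtain ⟨b, hb, hX⟩ := hcovers
  have hvalid := testBit_validMask_of _ hJtf b _ hb (segment (c.d - 1) m0 s).2 0 (dvd_zero 3)
    (fun i => by rw [Nat.zero_add]; exact hX i)
  have hsound := familyOKv_sound (le_refl 1) hfam b hb hvalid
  rw [laneSel_eq_of_covers b c.letterRows _ _ hJpw hX hJlt, xorFst_map_pair, xorSnd_map_pair] at hsound
  -- the decoded word is `enc (accX S, accZ S)`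
  have hword : xorList (((S' ++ [e]).map lidx).map fun j => c.letterRows.getD j 0) =
      c.enc (accX (S' ++ [e]), accZ (S' ++ [e])) := by
    rw [List.map_map]
    exact c.xorList_letterRows (S' ++ [e]) hlt hnz
  rw [hword] at hsound
  set w : ℕ × ℕ := (accX (S' ++ [e]), accZ (S' ++ [e])) with hw
  have hw1 : w.1 < 2 ^ c.n := accX_lt c.n _ hlt
  have hw2 : w.2 < 2 ^ c.n := accZ_lt c.n _ hlt
  show leaf c.n c.rows c.allowList w.1 w.2 = true
  rw [leaf]
  rcases hsound with hcnt | hleaf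
  · -- some syndrome bit is set: nonzero syndrome
    obtain ⟨q, hq⟩ := List.exists_mem_of_length_pos hcnt
    rw [List.mem_filter, List.mem_range] at hq
    obtain ⟨hqr, hbit⟩ := hq
    rw [c.testBit_enc w hw1, if_pos hqr, decide_eq_true_eq] at hbit
    have hsz : sympSynZero c.n c.rows (w.1, w.2) = false := by
      rw [Bool.eq_false_iff]
      intro hall
      rw [sympSynZero, List.all_eq_true] at hall
      have hmem : c.rows.getD q (0, 0) ∈ c.rows := by
        rw [List.getD_eq_getElem _ _ hqr]; exact List.getElem_mem hqr
      have := hall _ hmem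
      rw [beq_iff_eq] at this
      rw [this] at hbit
      exact absurd hbit (by norm_num)
    simp [hsz]
  · -- a straggler: identity or allow-listed
    rw [bzLeaf] at hleaf
    have hu : (xorList (((S' ++ [e]).map lidx).map fun j => 2 ^ j) == 0) = false := by
      rw [beq_eq_false_iff_ne, hJ]
      exact xorList_pow_concat_ne_zero _ _ hJ'lt
    have hwt : wtGt (c.rows.length + 2 * c.n) (c.enc w) = false := by
      rw [Bool.eq_false_iff]
      intro hgt
      have h1 := lt_popc_of_wtGt (c.rows.length + 2 * c.n) _ _ (c.enc_lt w hw1 hw2) hgt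
      have h2 := popc_le (c.rows.length + 2 * c.n) (c.enc w)
      omega
    rw [hu, hwt, Bool.false_or, Bool.false_or] at hleaf
    have hmem := List.mem_of_elem_eq_true hleaf
    rw [allowWords, List.mem_cons] at hmem
    rcases hmem with h0 | hmem
    · -- the identity word
      have hinj := c.enc_inj hw1 hw2 (Nat.two_pow_pos _) (Nat.two_pow_pos _) (h0.trans c.enc_zero.symm)
      have e1 : w.1 = 0 := congrArg Prod.fst hinj
      have e2 : w.2 = 0 := congrArg Prod.snd hinj
      simp [e1, e2]
    · obtain ⟨a, ha, hea⟩ := List.mem_map.1 hmem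
      have hinj := c.enc_inj hw1 hw2 (hbnd a ha).1 (hbnd a ha).2 hea.symm
      have : (w.1, w.2) = a := by rw [← hinj]
      rw [this]
      simp [ha]

/-- Identity letters do not change the accumulated `x`-word. -/
theorem accX_filter : ∀ S : Sel, accX (S.filter fun e => e.2.1 || e.2.2) = accX S
  | [] => rfl
  | (j, bx, bz) :: T => by
    rw [List.filter_cons]
    split_ifs with h
    · rw [accX, accX, accX_filter T]
    · have hbx : bx = false := by cases bx <;> simp_all
      rw [accX_filter T, accX, hbx]
      simp

/-- Identity letters do not change the accumulated `z`-word. -/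
theorem accZ_filter : ∀ S : Sel, accZ (S.filter fun e => e.2.1 || e.2.2) = accZ S
  | [] => rfl
  | (j, bx, bz) :: T => by
    rw [List.filter_cons]
    split_ifs with h
    · rw [accZ, accZ, accZ_filter T]
    · have hbz : bz = false := by cases bz <;> simp_all
      rw [accZ_filter T, accZ, hbz]
      simp

/-- **SOUNDNESS OF THE LANE REPLAY**: passing lane checks on segments covering the `3n` letter rows establish exactly
what type-02's replay establishes — `Reaches4 (leaf n rows allowList) (range n) (d − 1) 0 0`. -/
theorem reaches4_of_lanes (segs : List (ℕ × ℕ)) (fuel : ℕ) (hs : c.checkStructureL = true)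
    (hcov : ∀ m < 3 * c.n, ∃ i < segs.length,
      (segs.getD i (0, 0)).1 ≤ m ∧ m < (segs.getD i (0, 0)).1 + (segs.getD i (0, 0)).2)
    (hok : ∀ i < segs.length, c.laneCheck (segs.getD i (0, 0)).1 (segs.getD i (0, 0)).2 fuel = true) :
    Reaches4 (leaf c.n c.rows c.allowList) (List.range c.n) (c.d - 1) 0 0 := by
  have hbnd : ∀ a ∈ c.allowList, a.1 < 2 ^ c.n ∧ a.2 < 2 ^ c.n := by
    rw [checkStructureL, Bool.and_eq_true, List.all_eq_true] at hs
    intro a ha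
    have := hs.2 a ha
    simp only [Bool.and_eq_true, decide_eq_true_eq] at this
    exact this
  intro S hsub hlen
  rw [Nat.zero_xor, Nat.zero_xor, ← accX_filter S, ← accZ_filter S]
  set S' := S.filter fun e => e.2.1 || e.2.2 with hS'
  by_cases hne : S' = []
  · rw [hne, accX, accZ]; simp [leaf]
  · refine c.leaf_of_laneChecks segs fuel hcov hok hbnd S' ?_ ?_ ?_ hne
    · exact (List.Sublist.map Prod.fst List.filter_sublist).trans hsub
    · exact (List.length_filter_le _ _).trans hlen
    · intro e he; exact (List.mem_filter.1 he).2

end AddCert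

end Summit.Ventures.QEC.Census
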